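import Summits.CriticalPhenomena.PercolationContinuityZ3.Theorems.PercNearOneGluingNoHeavyQuantGateMoveBlob
import HarnessLib

/-!
# QUANT lane R8, T-DEC, leg (III): the blob gate move (M) WITHOUT the support hypothesis is FALSE — `hsupp` in
# `LawDec.decAtT_gateMoveBlob` is necessary (explicit exact witness)

builds on p205010 (kernel theorem, internal audit signed; external expert review pending)

Support file (`--supports stmt-CriticalPhenomena-4575`), QUANT lane seat prim-quant-arm-3 (gen 62; V278 second-seat literal test of the lane's
"statement of record" for the blob case of (III), lead g30 README V317 (c): typer g27's `decAtT_gateMoveBlob` binder WITHOUT `hsupp`).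
Theorems only, standard axioms, no sorries, no definitions, no notation.

THE STATEMENT UNDER TEST ((M) for general `a`): `0 < y < 1`, `0 ≤ z ≤ ν 0`, `g ≤ 1`, `y ≤ (1−z)g`, `1 ≤ a`, `ν` a probability law on `{0..M}`
with mean `S`, `y·M ≤ S`; `Λ := slice ν a g` DEC at `(y, S + ag, j)` (top `M + a`) ⟹ `Λ + gz(δ₀ − δ_a)` DEC at `(y, S + ag − zag, j)`.
(typer g27 proved it under `hsupp : (1−g)·ν k = 0` for `0 < k < a`; arm-1 g39 derived it for every `a` from `TwinMoveDEC`, refuted in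
`…QuantTwinMoveWitness`.)

THE WITNESS (this file): `ν = {0: 1/100, 1: 99/125, 14: 99/500}` (`M = 14`, `S = 891/250`), `a = 2`, `g = 1/4`, `z = 1/100 = ν 0`, `y = 99/400 = (1−z)g`
(threshold tight; `y·M = 693/200 ≤ S`), `j = 3`.  `hsupp` fails: `(1−g)·ν 1 = 297/500 ≠ 0` with `0 < 1 < a`.
HYPOTHESIS: `Λ = slice ν 2 (1/4) = {0: 3/400, 1: 297/500, 2: 1/400, 3: 99/500, 14: 297/2000, 16: 99/2000}` is DEC at `(99/400, 508/125, 3)`, top `16`: flow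
`0 → 16: 3/400`, `1 → 14: 451/1000`, `1 → 16: 143/1000` (giant usage `99/301`; the giant `16` exactly full), `2 → 3: 1/400` (the blob atom `a = 2` is a LOW here,
`2a < 508/125`, shipped into the mid `3`, heavy-branch usage `87533/712467`).  CONCLUSION FAILS: `P = Λ + (1/400)(δ₀ − δ₂) = {0: 1/100, 1: 297/500, 3: 99/500,
14: 297/2000, 16: 99/2000}` at `(99/400, 4059/1000, 3)`: lows `{0, 1}` carry `151/250`; the mid `3` is incompatible with both (`0 + 3, 1 + 3 < 4059/1000`), the
atoms `4..13, 15` are empty, the giants `14, 16` take at most `(297/2000 + 99/2000)·301/99 = 301/500 < 151/250`.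
MECHANISM: the move takes the blob mass `gz` from the low `a` — which `Λ` ships into the cheap compatible mid `a + 1` — to the low `0`, which only the
exactly-full giants can take.  Not touched: `GateMove` (GM′, SDEC hypotheses on the factors: `ν̂ = {1: 4/5, 14: 1/5}` is not SDEC at `1/4`), the window
forms (`SliceClosedWindowT`, a theorem), PM / `GatedConvEmptyFree` / `SDECConvClosed`.

* `gateMoveBlob_witness_hyp` — `Λ` is DEC;  `gateMoveBlob_witness_not` — `P` is not DEC;
* **`gateMoveBlob_hsupp_necessary`** — `∃ y z g S a j M ν`, every hypothesis of `decAtT_gateMoveBlob` except `hsupp` ∧ `¬` its conclusion.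

Evidence: memo `run/shared/lean/prim/quant/prim-quant-arm-3-g62/TWINMOVE-CEX-G62.md` §T3 (kit j172087: 2 / 384 000 in the targeted census with (M)'s own
top-affordability cap; the second witness has TA and threshold slack).

[this work]; the statement under test: prim-quant-stmt g27 / prim-quant-lead g30 (this lane).  Nothing here is cited as a published result.  The gluing rows
served [cite: KozmaNitzan2024, Conjecture 3 (p. 15)]; product measure [cite: Grimmett1999, §1.3 p. 10].
-/

noncomputable section

namespace Summit.CriticalPhenomena.PercolationContinuityZ3.Theorems

namespace Quant

open Finset

namespace LawDec

/-- usage of a low atom at a GIANT absorber `h ≥ j′+1` is `x/(1−x)`. -/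
private theorem usage_of_giant'' (x T : ℝ) (j' l h : ℕ) (hjh : j' + 1 ≤ h) : usage x T j' l h = x / (1 - x) := by
  simp only [usage, gateOf, if_pos hjh]

/-- usage of a low atom at a MID absorber `h ≤ j′` when the credit gate is the heavy branch `x² + (1−x)ρ ≥ ρ`. -/
private theorem usage_of_mid' (x T ρ : ℝ) (j' l h : ℕ) (hjh : ¬ j' + 1 ≤ h) (hρ : (T - 2 * (l : ℝ)) / ((h : ℝ) - l) = ρ)
    (hle : ρ ≤ x ^ 2 + (1 - x) * ρ) :
    usage x T j' l h = (x ^ 2 + (1 - x) * ρ) / (1 - (x ^ 2 + (1 - x) * ρ)) := by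
  simp only [usage, gateOf, if_neg hjh, pairGate, hρ, max_eq_right hle]

/-- **HYPOTHESIS of the witness holds**: `Λ = slice ν 2 (1/4)` is DEC at `(99/400, 508/125, 3)`, top `16`. [this work] -/
theorem gateMoveBlob_witness_hyp : DECAtT (99 / 400) (508 / 125) 3 16 (fun h : ℕ => (if h = 0 then (3 : ℝ) / 400 else if h = 1 then 297 / 500 else if h = 2 then 1 / 400 else if h = 3 then 99 / 500 else if h = 14 then 297 / 2000 else if h = 16 then 99 / 2000 else 0)) := by
  have l_top : ∀ h, 16 < h → (fun h : ℕ => (if h = 0 then (3 : ℝ) / 400 else if h = 1 then 297 / 500 else if h = 2 then 1 / 400 else if h = 3 then 99 / 500 else if h = 14 then 297 / 2000 else if h = 16 then 99 / 2000 else 0)) h = 0 := by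
    intro h hh; dsimp only
    rw [if_neg (by omega), if_neg (by omega), if_neg (by omega), if_neg (by omega), if_neg (by omega), if_neg (by omega)]
  have l_mass : ∑ h ∈ Finset.range (16 + 1), (fun h : ℕ => (if h = 0 then (3 : ℝ) / 400 else if h = 1 then 297 / 500 else if h = 2 then 1 / 400 else if h = 3 then 99 / 500 else if h = 14 then 297 / 2000 else if h = 16 then 99 / 2000 else 0)) h = 1 := by
    simp only [Finset.sum_range_succ, Finset.sum_range_zero]; norm_num
  rw [decAtT_iff_flowAtT _ _ 3 16 _ (by norm_num) (by norm_num) l_top l_mass]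
  have ug : ∀ l h, 3 + 1 ≤ h → usage (99 / 400 : ℝ) (508 / 125) 3 l h = 99 / 301 := by
    intro l h hh; rw [usage_of_giant'' (99 / 400) (508 / 125) 3 l h hh]; norm_num
  have u23 : usage (99 / 400 : ℝ) (508 / 125) 3 2 3 = 87533 / 712467 := by
    rw [usage_of_mid' (99 / 400) (508 / 125) (8 / 125) 3 2 3 (by norm_num) (by norm_num) (by norm_num)]; norm_num
  refine ⟨fun l h => if l = 0 then (if h = 16 then 3 / 400 else 0) else if l = 1 then (if h = 14 then 451 / 1000 else if h = 16 then 143 / 1000 else 0)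
      else if l = 2 then (if h = 3 then 1 / 400 else 0) else 0, ?_, ?_, ?_, ?_⟩
  · intro l h
    dsimp only
    split_ifs <;> norm_num
  · intro l h hlh
    dsimp only at hlh
    split_ifs at hlh with h1 h2 h3 h4 h5 h6 h7
    · subst h1; subst h2; norm_num
    · exact absurd hlh (lt_irrefl 0)
    · subst h3; subst h4; norm_num
    · subst h3; subst h5; norm_num
    · exact absurd hlh (lt_irrefl 0)
    · subst h6; subst h7; norm_num
    · exact absurd hlh (lt_irrefl 0)
    · exact absurd hlh (lt_irrefl 0)
  · intro l hl hlow
    interval_cases l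
    · simp only [Finset.sum_range_succ, Finset.sum_range_zero]; norm_num
    · simp only [Finset.sum_range_succ, Finset.sum_range_zero]; norm_num
    · simp only [Finset.sum_range_succ, Finset.sum_range_zero]; norm_num
    · exfalso; norm_num at hlow
  · intro h hh habs
    interval_cases h <;> simp only [Finset.sum_range_succ, Finset.sum_range_zero] <;> norm_num [ug, u23]

/-- **CONCLUSION of the witness fails**: `P = Λ + (1/400)(δ₀ − δ₂)` is NOT DEC at `(99/400, 4059/1000, 3)`, top `16`. [this work] -/
theorem gateMoveBlob_witness_not : ¬ DECAtT (99 / 400) (4059 / 1000) 3 16 (fun h : ℕ => (if h = 0 then (1 : ℝ) / 100 else if h = 1 then 297 / 500 else if h = 3 then 99 / 500 else if h = 14 then 297 / 2000 else if h = 16 then 99 / 2000 else 0)) := by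
  have p_top : ∀ h, 16 < h → (fun h : ℕ => (if h = 0 then (1 : ℝ) / 100 else if h = 1 then 297 / 500 else if h = 3 then 99 / 500 else if h = 14 then 297 / 2000 else if h = 16 then 99 / 2000 else 0)) h = 0 := by
    intro h hh; dsimp only
    rw [if_neg (by omega), if_neg (by omega), if_neg (by omega), if_neg (by omega), if_neg (by omega)]
  have p_mass : ∑ h ∈ Finset.range (16 + 1), (fun h : ℕ => (if h = 0 then (1 : ℝ) / 100 else if h = 1 then 297 / 500 else if h = 3 then 99 / 500 else if h = 14 then 297 / 2000 else if h = 16 then 99 / 2000 else 0)) h = 1 := by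
    simp only [Finset.sum_range_succ, Finset.sum_range_zero]; norm_num
  rw [decAtT_iff_flowAtT _ _ 3 16 _ (by norm_num) (by norm_num) p_top p_mass]
  rintro ⟨f, hf0, hsupp, hlow, hcap⟩
  have ug : ∀ l h, 3 + 1 ≤ h → usage (99 / 400 : ℝ) (4059 / 1000) 3 l h = 99 / 301 := by
    intro l h hh; rw [usage_of_giant'' (99 / 400) (4059 / 1000) 3 l h hh]; norm_num
  have hz : ∀ l h : ℕ, ¬ (l ≤ 3 ∧ 2 * (l : ℝ) < 4059 / 1000 ∧ h ≤ 16 ∧ (3 + 1 ≤ h ∨ (4059 / 1000 : ℝ) < (l : ℝ) + h)) → f l h = 0 := by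
    intro l h hn
    by_contra hne
    exact hn (hsupp l h (lt_of_le_of_ne (hf0 l h) (Ne.symm hne)))
  -- row 3 is not a low; row 2 is a low of mass 0; the cells (0, h ≤ 3) and (1, h ≤ 3) are incompatible
  have r3 : ∀ h, f 3 h = 0 := fun h => hz 3 h (by norm_num)
  have r2 : ∀ h, f 2 h = 0 := by
    intro h
    have hs := hlow 2 (by norm_num) (by norm_num)
    norm_num at hs
    by_cases hh : h < 16 + 1
    · exact (Finset.sum_eq_zero_iff_of_nonneg (fun k _ => hf0 2 k)).1 hs h (Finset.mem_range.2 hh)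
    · exact hz 2 h (fun hc => hh (by have h7 := hc.2.2.1; omega))
  have z00 : f 0 0 = 0 := hz 0 0 (by norm_num)
  have z01 : f 0 1 = 0 := hz 0 1 (by norm_num)
  have z02 : f 0 2 = 0 := hz 0 2 (by norm_num)
  have z03 : f 0 3 = 0 := hz 0 3 (by norm_num)
  have z10 : f 1 0 = 0 := hz 1 0 (by norm_num)
  have z11 : f 1 1 = 0 := hz 1 1 (by norm_num)
  have z12 : f 1 2 = 0 := hz 1 2 (by norm_num)
  have z13 : f 1 3 = 0 := hz 1 3 (by norm_num)
  -- the empty giants 4..13 and 15 absorb nothing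
  have col : ∀ h, 3 + 1 ≤ h → h ≤ 16 → h ≠ 14 → h ≠ 16 → f 0 h = 0 ∧ f 1 h = 0 := by
    intro h h4 h16 h14 h16'
    have c := hcap h h16 (Or.inl h4)
    have hP : (fun h : ℕ => (if h = 0 then (1 : ℝ) / 100 else if h = 1 then 297 / 500 else if h = 3 then 99 / 500 else if h = 14 then 297 / 2000 else if h = 16 then 99 / 2000 else 0)) h = 0 := by
      dsimp only; rw [if_neg (by omega), if_neg (by omega), if_neg (by omega), if_neg (by omega), if_neg (by omega)]
    rw [hP] at c
    simp only [Finset.sum_range_succ, Finset.sum_range_zero, zero_add] at c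
    rw [ug 0 h h4, ug 1 h h4, ug 2 h h4, ug 3 h h4, r2 h, r3 h] at c
    constructor <;> nlinarith [hf0 0 h, hf0 1 h]
  obtain ⟨a4, b4⟩ := col 4 (by norm_num) (by norm_num) (by norm_num) (by norm_num)
  obtain ⟨a5, b5⟩ := col 5 (by norm_num) (by norm_num) (by norm_num) (by norm_num)
  obtain ⟨a6, b6⟩ := col 6 (by norm_num) (by norm_num) (by norm_num) (by norm_num)
  obtain ⟨a7, b7⟩ := col 7 (by norm_num) (by norm_num) (by norm_num) (by norm_num)
  obtain ⟨a8, b8⟩ := col 8 (by norm_num) (by norm_num) (by norm_num) (by norm_num)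
  obtain ⟨a9, b9⟩ := col 9 (by norm_num) (by norm_num) (by norm_num) (by norm_num)
  obtain ⟨a10, b10⟩ := col 10 (by norm_num) (by norm_num) (by norm_num) (by norm_num)
  obtain ⟨a11, b11⟩ := col 11 (by norm_num) (by norm_num) (by norm_num) (by norm_num)
  obtain ⟨a12, b12⟩ := col 12 (by norm_num) (by norm_num) (by norm_num) (by norm_num)
  obtain ⟨a13, b13⟩ := col 13 (by norm_num) (by norm_num) (by norm_num) (by norm_num)
  obtain ⟨a15, b15⟩ := col 15 (by norm_num) (by norm_num) (by norm_num) (by norm_num)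
  have e0 := hlow 0 (by norm_num) (by norm_num)
  have e1 := hlow 1 (by norm_num) (by norm_num)
  have c14 := hcap 14 (by norm_num) (Or.inl (by norm_num))
  have c16 := hcap 16 (by norm_num) (Or.inl (by norm_num))
  simp only [Finset.sum_range_succ, Finset.sum_range_zero, zero_add] at e0 e1 c14 c16
  norm_num at e0 e1 c14 c16
  rw [z00, z01, z02, z03, a4, a5, a6, a7, a8, a9, a10, a11, a12, a13, a15] at e0
  rw [z10, z11, z12, z13, b4, b5, b6, b7, b8, b9, b10, b11, b12, b13, b15] at e1
  rw [r2 14, r3 14, ug 0 14 (by norm_num), ug 1 14 (by norm_num)] at c14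
  rw [r2 16, r3 16, ug 0 16 (by norm_num), ug 1 16 (by norm_num)] at c16
  norm_num at e0 e1 c14 c16
  nlinarith [hf0 0 14, hf0 0 16, hf0 1 14, hf0 1 16]

/-- **`hsupp` IS NECESSARY in `decAtT_gateMoveBlob` — the blob gate move (M) for general `a` is false as a one-layer statement (arm-3 g62).**
`y = 99/400`, `z = 1/100`, `g = 1/4`, `S = 891/250`, `a = 2`, `j = 3`, `M = 14`, `ν = {0: 1/100, 1: 99/125, 14: 99/500}` satisfy every hypothesis of
typer g27's `decAtT_gateMoveBlob` except `hsupp` (the unshifted atom `1 < a` carries `(1−g)·99/125 ≠ 0`), and its conclusion fails.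
builds on p205010 (kernel theorem, internal audit signed; external expert review pending). [this work] -/
theorem gateMoveBlob_hsupp_necessary :
    ∃ (y z g S : ℝ) (a j M : ℕ) (ν : ℕ → ℝ),
      0 < y ∧ y < 1 ∧ 0 ≤ z ∧ g ≤ 1 ∧ y ≤ (1 - z) * g ∧ 1 ≤ a ∧
      (∀ h, 0 ≤ ν h) ∧ (∀ h, M < h → ν h = 0) ∧ (∑ h ∈ Finset.range (M + 1), ν h = 1) ∧
      S = ∑ h ∈ Finset.range (M + 1), (h : ℝ) * ν h ∧ y * (M : ℝ) ≤ S ∧ z ≤ ν 0 ∧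
      ¬ (∀ k, 0 < k → k < a → (1 - g) * ν k = 0) ∧
      DECAtT y (S + (a : ℝ) * g) j (M + a) (slice ν a g) ∧
      ¬ DECAtT y (S + (a : ℝ) * g - z * (a : ℝ) * g) j (M + a)
        (fun h => slice ν a g h + g * z * ((if h = 0 then (1 : ℝ) else 0) - (if h = a then (1 : ℝ) else 0))) := by
  have hmean : ∑ h ∈ Finset.range (14 + 1), (h : ℝ) * (fun h : ℕ => (if h = 0 then (1 : ℝ) / 100 else if h = 1 then 99 / 125 else if h = 14 then 99 / 500 else 0)) h = 891 / 250 := by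
    simp only [Finset.sum_range_succ, Finset.sum_range_zero]; norm_num
  have hmass : ∑ h ∈ Finset.range (14 + 1), (fun h : ℕ => (if h = 0 then (1 : ℝ) / 100 else if h = 1 then 99 / 125 else if h = 14 then 99 / 500 else 0)) h = 1 := by
    simp only [Finset.sum_range_succ, Finset.sum_range_zero]; norm_num
  have hslice : ∀ h : ℕ, slice (fun h : ℕ => (if h = 0 then (1 : ℝ) / 100 else if h = 1 then 99 / 125 else if h = 14 then 99 / 500 else 0)) 2 (1 / 4) h = (fun h : ℕ => (if h = 0 then (3 : ℝ) / 400 else if h = 1 then 297 / 500 else if h = 2 then 1 / 400 else if h = 3 then 99 / 500 else if h = 14 then 297 / 2000 else if h = 16 then 99 / 2000 else 0)) h := by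
    intro h
    simp only [slice]
    rcases h with _ | _ | _ | _ | _ | _ | _ | _ | _ | _ | _ | _ | _ | _ | _ | _ | _ | h
    all_goals norm_num
    all_goals (try simp)
  refine ⟨99 / 400, 1 / 100, 1 / 4, 891 / 250, 2, 3, 14, (fun h : ℕ => (if h = 0 then (1 : ℝ) / 100 else if h = 1 then 99 / 125 else if h = 14 then 99 / 500 else 0)), by norm_num, by norm_num, by norm_num, by norm_num, by norm_num, by norm_num,
    ?_, ?_, hmass, hmean.symm, by norm_num, by norm_num, ?_, ?_, ?_⟩
  · intro h; dsimp only; split_ifs <;> norm_num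
  · intro h hh; dsimp only; rw [if_neg (by omega), if_neg (by omega), if_neg (by omega)]
  · intro hs
    have := hs 1 (by norm_num) (by norm_num)
    norm_num at this
  · have hfun : slice (fun h : ℕ => (if h = 0 then (1 : ℝ) / 100 else if h = 1 then 99 / 125 else if h = 14 then 99 / 500 else 0)) 2 (1 / 4) = (fun h : ℕ => (if h = 0 then (3 : ℝ) / 400 else if h = 1 then 297 / 500 else if h = 2 then 1 / 400 else if h = 3 then 99 / 500 else if h = 14 then 297 / 2000 else if h = 16 then 99 / 2000 else 0)) := funext hslice
    rw [hfun, show ((891 : ℝ) / 250 + ((2 : ℕ) : ℝ) * (1 / 4)) = 508 / 125 by norm_num]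
    exact gateMoveBlob_witness_hyp
  · have hfun : (fun h : ℕ => slice (fun h : ℕ => (if h = 0 then (1 : ℝ) / 100 else if h = 1 then 99 / 125 else if h = 14 then 99 / 500 else 0)) 2 (1 / 4) h + (1 / 4 : ℝ) * (1 / 100) * ((if h = 0 then (1 : ℝ) else 0) - (if h = 2 then (1 : ℝ) else 0))) = (fun h : ℕ => (if h = 0 then (1 : ℝ) / 100 else if h = 1 then 297 / 500 else if h = 3 then 99 / 500 else if h = 14 then 297 / 2000 else if h = 16 then 99 / 2000 else 0)) := by
      funext h
      rw [hslice h]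
      rcases h with _ | _ | _ | _ | _ | _ | _ | _ | _ | _ | _ | _ | _ | _ | _ | _ | _ | h
      all_goals norm_num
      all_goals (try simp)
    rw [hfun, show ((891 : ℝ) / 250 + ((2 : ℕ) : ℝ) * (1 / 4) - (1 / 100) * ((2 : ℕ) : ℝ) * (1 / 4)) = 4059 / 1000 by norm_num]
    exact gateMoveBlob_witness_not

end LawDec

end Quant

end Summit.CriticalPhenomena.PercolationContinuityZ3.Theorems
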